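import Literature.NumberTheory.Automorphic.Liu2021.AppendixC.HeckeEndomorphism
import Literature.NumberTheory.Automorphic.HeckeOperatorAdjointBilinear
import HarnessLib

/-!
# [Liu 2021, §4.2 / App. D §D.4] the Hecke endomorphisms `[KgK]`, `[Kg⁻¹K]` of `A_K` are ADJOINT for every
# `𝔾(𝔸_F^∞)`-invariant pairing on the `ℓ`-adic tower `H¹_ét(A_∞)`

Topic `NumberTheory/Automorphic/Liu2021/AppendixC`; namespace
`Literature.NumberTheory.Automorphic.Liu2021.AppendixC.Sec42Data.HeckeTranslates`.  Theorems only — no definition, no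
named fact, no instance, no `sorry`; imports = ★ `HeckeEndomorphism` (`heckeEnd`, `toTower_dualMap_rationalTateAction_heckeEnd`)
+ ★ `HeckeOperatorAdjointBilinear` (`invariantPairing_heckeOperator_apply_eq_heckeOperator_inv`).

Setting: a §4.2 datum `C` with Hecke translates `T` and row (D) `hD : T.IsogenyDescent`, a prime `ℓ`, the `ℓ`-adic tower
`C.etaleH1Tower ℓ = lim_K H¹_ét(A_K ⊗ Ē, ℚ_ℓ)` with its level maps `[·]_K = C.toTower ℓ K` and the Hecke representation
`T.etHeckeRep ℓ` of `C.G = 𝔾(𝔸_F^∞)` (★ `EtaleHeckeDatumOfTranslates`).  Print, [Liu2021] p. 133 before (D.3): the Hecke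
actions give `C_c^∞(K\G(𝔸^∞)/K, ℚ) → End(A_K)_ℚ`; the tree's value on `𝟙_{KgK}` is ★ `heckeEnd T hD K g ∈ End⁰(A_K)`, pinned by
`[ᵗ(V_ℓ^ℚ heckeEnd g) φ]_K = [KgK] [φ]_K` (★ `toTower_dualMap_rationalTateAction_heckeEnd`).

* `pairing_toTower_heckeEnd_eq` — for ANY pairing `B : H¹_ét(A_∞) × W₂ → W` between the tower and a second representation
  `ρ₂` of `C.G`, invariant (`B (g·x) (ρ₂ g y) = B x y`), any `ρ₂`-`K`-fixed `y`, and `#(Kg⁻¹K/K) = #(KgK/K)`: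
  `B [ᵗ(V_ℓ^ℚ [KgK]) φ]_K y = B [φ]_K ([Kg⁻¹K]·y)`;
* **`bilin_toTower_heckeEnd_eq`** — the one-tower bilinear form: for an `etHeckeRep`-invariant bilinear form `B` on the
  tower, `B [ᵗ(V_ℓ^ℚ [KgK]) φ]_K [ψ]_K = B [φ]_K [ᵗ(V_ℓ^ℚ [Kg⁻¹K]) ψ]_K` — «`[KgK]` and `[Kg⁻¹K]` are adjoint»;
* `bilin_toTower_heckeEnd_comm_of_inv_mem` — if `g⁻¹ ∈ KgK` then `[KgK]` is `B`-self-adjoint at level `K`;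
* **`bilin_toTower_ncard_smul_heckeEnd_eq`** — WITHOUT `hdeg`: `#(Kg⁻¹K/K) • B [ᵗ[KgK] φ]_K [ψ]_K = #(KgK/K) • B [φ]_K [ᵗ[Kg⁻¹K] ψ]_K`
  (the adjoint of `[KgK]` is a positive rational multiple of `[Kg⁻¹K]` — enough for Rosati-STABILITY of the Hecke image);
* `ncard_orbit_level_pos` — the counts are positive.

This is the representation-theoretic half of the statement «the Rosati involution of the canonical polarisation of
`A_K = Alb(X_K)` sends `[KgK]` to `[Kg⁻¹K]`» ([Liu2021] App. D §D.4 argues through the Rosati involution; classically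
[MumfordAV1970] §20–21, Diamond–Shurman Prop. 5.5.2 for modular Jacobians): once an invariant non-degenerate `B` whose
pull-back along `[·]_K` is the `ℓ`-adic Weil pairing of a polarisation of `A_K` is supplied (cell hodgecm-mathlib road (P),
legs (T2)/(T3) — NOT in this file), the Rosati image of `heckeEnd g` is `heckeEnd g⁻¹` by ★ `eq_heckeEnd`.  The ONE hypothesis
beyond invariance is `hdeg : #(Kg⁻¹K/K) = #(KgK/K)` (unimodularity of `𝔾(𝔸_F^∞)` at compact open level; ★
`ncard_orbit_inv_eq_of_isCompact_isOpen` discharges it from an inversion-invariant Haar measure).  HC_CM is proved only modulo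
the 7 printed citations until rung 0 closes; this file moves no book (count-neutral capital, road (P) leg (T1′)).

## References
* [Liu2021] Y. Liu, *Fourier–Jacobi cycles and arithmetic relative trace formula*, Camb. J. Math. 9 (2021): §4.2 (FJcycle.tex
  l. 2074), §4.3 (l. 2160), p. 133 (before (D.3)), App. D §D.4.
* [DiamondShurman2005] F. Diamond, J. Shurman, *A First Course in Modular Forms* (2005), Prop. 5.5.2.
* [DeitmarEchterhoff2014] A. Deitmar, S. Echterhoff, *Principles of Harmonic Analysis*, 2nd ed. (2014), Prop. 6.2.1.
-/

set_option autoImplicit false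

noncomputable section

open CategoryTheory NumberField MulAction
open Literature.AlgebraicGeometry.Motives.AbelianVariety (rationalTateAction)

namespace Literature.NumberTheory.Automorphic.Liu2021.AppendixC

variable {F E : Type} [Field F] [NumberField F] [IsTotallyReal F] [Field E] [NumberField E] [Algebra F E]
  [IsTotallyComplex E] [Algebra.IsQuadraticExtension F E]
variable {P5 : PropC5Data F E} {isotropicAt : ℕ → Prop}

namespace Sec42Data.HeckeTranslates

variable {C : Sec42Data P5 isotropicAt} (T : C.HeckeTranslates) (ℓ : ℕ) [Fact ℓ.Prime]

/-- The level map `[·]_K` lands in the `K`-fixed vectors of the Hecke representation on the tower (★ `etHeckeRep_toTower_of_mem`,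
in the `Representation.fixedPoints` spelling). [cite: Liu2021, Thm. 4.18 (1) l. 2239] -/
theorem toTower_mem_fixedPoints (K : C5.SmallLevel C.S.K₀) (φ : C.etaleH1 ℓ K) :
    C.toTower ℓ K φ ∈ (T.etHeckeRep ℓ).fixedPoints (K.1.1 : Subgroup C.G) :=
  (Representation.mem_fixedPoints _ _ _).2 fun _ hk => T.etHeckeRep_toTower_of_mem ℓ hk φ

/-- **`[KgK]` and `[Kg⁻¹K]` are adjoint for any invariant pairing of the tower with a second representation.**  For a pairing
`B : H¹_ét(A_∞) → W₂ → W` invariant under `(etHeckeRep, ρ₂)`, a `ρ₂`-`K`-fixed `y`, and `#(Kg⁻¹K/K) = #(KgK/K)`: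
`B [ᵗ(V_ℓ^ℚ [KgK]) φ]_K y = B [φ]_K ([Kg⁻¹K] y)`. [cite: Liu2021, p. 133 (before (D.3)) and §4.2 (FJcycle.tex l. 2074)]
[cite: DeitmarEchterhoff2014, Prop. 6.2.1] -/
theorem pairing_toTower_heckeEnd_eq (hD : T.IsogenyDescent) {V₂ W : Type*} [AddCommGroup V₂] [Module ℚ_[ℓ] V₂]
    [AddCommGroup W] [Module ℚ_[ℓ] W] (ρ₂ : Representation ℚ_[ℓ] C.G V₂) (B : C.etaleH1Tower ℓ →ₗ[ℚ_[ℓ]] V₂ →ₗ[ℚ_[ℓ]] W)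
    (hB : ∀ (g : C.G) (x : C.etaleH1Tower ℓ) (y : V₂), B (T.etHeckeRep ℓ g x) (ρ₂ g y) = B x y)
    (K : C5.SmallLevel C.S.K₀) (g : C.G)
    (hdeg : (orbit K.1.1 ((g⁻¹ : C.G) : C.G ⧸ (K.1.1 : Subgroup C.G))).ncard =
      (orbit K.1.1 (g : C.G ⧸ (K.1.1 : Subgroup C.G))).ncard)
    (φ : C.etaleH1 ℓ K) {y : V₂} (hy : y ∈ ρ₂.fixedPoints (K.1.1 : Subgroup C.G)) :
    B (C.toTower ℓ K ((rationalTateAction (C.A K) ℓ (T.heckeEnd hD K g)).dualMap φ)) y =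
      B (C.toTower ℓ K φ) (heckeOperator ρ₂ (K.1.1 : Subgroup C.G) g⁻¹ y) := by
  rw [T.toTower_dualMap_rationalTateAction_heckeEnd ℓ hD K g φ]
  exact invariantPairing_heckeOperator_apply_eq_heckeOperator_inv (T.etHeckeRep ℓ) ρ₂ B hB (K.1.1 : Subgroup C.G) g
    (Sec42Data.BettiPinning.finite_orbit_level K g) (Sec42Data.BettiPinning.finite_orbit_level K g⁻¹) hdeg
    (T.toTower_mem_fixedPoints ℓ K φ) hy

/-- **`[KgK]` and `[Kg⁻¹K]` are adjoint endomorphisms of `A_K` for every invariant bilinear form on the `ℓ`-adic tower.**  For an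
`etHeckeRep`-invariant bilinear form `B` on `H¹_ét(A_∞)` and `#(Kg⁻¹K/K) = #(KgK/K)`:
`B [ᵗ(V_ℓ^ℚ (heckeEnd g)) φ]_K [ψ]_K = B [φ]_K [ᵗ(V_ℓ^ℚ (heckeEnd g⁻¹)) ψ]_K` — the `ℓ`-adic shadow of «the Rosati involution
(of a Hecke-compatible polarisation) sends `[KgK]` to `[Kg⁻¹K]`». [cite: Liu2021, p. 133 (before (D.3)) and §4.2 (FJcycle.tex l. 2074)]
[cite: DiamondShurman2005, Prop. 5.5.2] -/
theorem bilin_toTower_heckeEnd_eq (hD : T.IsogenyDescent) (B : LinearMap.BilinForm ℚ_[ℓ] (C.etaleH1Tower ℓ))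
    (hB : ∀ (g : C.G) (x y : C.etaleH1Tower ℓ), B (T.etHeckeRep ℓ g x) (T.etHeckeRep ℓ g y) = B x y)
    (K : C5.SmallLevel C.S.K₀) (g : C.G)
    (hdeg : (orbit K.1.1 ((g⁻¹ : C.G) : C.G ⧸ (K.1.1 : Subgroup C.G))).ncard =
      (orbit K.1.1 (g : C.G ⧸ (K.1.1 : Subgroup C.G))).ncard)
    (φ ψ : C.etaleH1 ℓ K) :
    B (C.toTower ℓ K ((rationalTateAction (C.A K) ℓ (T.heckeEnd hD K g)).dualMap φ)) (C.toTower ℓ K ψ) =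
      B (C.toTower ℓ K φ) (C.toTower ℓ K ((rationalTateAction (C.A K) ℓ (T.heckeEnd hD K g⁻¹)).dualMap ψ)) := by
  rw [T.toTower_dualMap_rationalTateAction_heckeEnd ℓ hD K g⁻¹ ψ]
  exact T.pairing_toTower_heckeEnd_eq ℓ hD (T.etHeckeRep ℓ) B hB K g hdeg φ (T.toTower_mem_fixedPoints ℓ K ψ)

/-- **Self-adjoint case**: if `g⁻¹ ∈ KgK` then `[KgK]` is `B`-self-adjoint at level `K`:
`B [ᵗ(V_ℓ^ℚ (heckeEnd g)) φ]_K [ψ]_K = B [φ]_K [ᵗ(V_ℓ^ℚ (heckeEnd g)) ψ]_K`. [cite: DiamondShurman2005, Prop. 5.5.2]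
[cite: Liu2021, p. 133 (before (D.3)) and §4.2 (FJcycle.tex l. 2074)] -/
theorem bilin_toTower_heckeEnd_comm_of_inv_mem (hD : T.IsogenyDescent) (B : LinearMap.BilinForm ℚ_[ℓ] (C.etaleH1Tower ℓ))
    (hB : ∀ (g : C.G) (x y : C.etaleH1Tower ℓ), B (T.etHeckeRep ℓ g x) (T.etHeckeRep ℓ g y) = B x y)
    (K : C5.SmallLevel C.S.K₀) (g : C.G) (hg : g⁻¹ ∈ DoubleCoset.doubleCoset g ((K.1.1 : Subgroup C.G) : Set C.G) K.1.1)
    (φ ψ : C.etaleH1 ℓ K) :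
    B (C.toTower ℓ K ((rationalTateAction (C.A K) ℓ (T.heckeEnd hD K g)).dualMap φ)) (C.toTower ℓ K ψ) =
      B (C.toTower ℓ K φ) (C.toTower ℓ K ((rationalTateAction (C.A K) ℓ (T.heckeEnd hD K g)).dualMap ψ)) := by
  rw [T.toTower_dualMap_rationalTateAction_heckeEnd ℓ hD K g φ, T.toTower_dualMap_rationalTateAction_heckeEnd ℓ hD K g ψ]
  exact bilin_heckeOperator_apply_comm_of_inv_mem (T.etHeckeRep ℓ) B hB (K.1.1 : Subgroup C.G) g
    (Sec42Data.BettiPinning.finite_orbit_level K g) hg (T.toTower_mem_fixedPoints ℓ K φ) (T.toTower_mem_fixedPoints ℓ K ψ)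

/-! ### Without unimodularity: the cross-multiplied form (enough for the Rosati-STABILITY of the Hecke algebra) -/

/-- **No `hdeg` needed for stability**: for an `etHeckeRep`-invariant bilinear form `B` on the tower and ANY `g`,
`#(Kg⁻¹K/K) • B [ᵗ(V_ℓ^ℚ (heckeEnd g)) φ]_K [ψ]_K = #(KgK/K) • B [φ]_K [ᵗ(V_ℓ^ℚ (heckeEnd g⁻¹)) ψ]_K`, both counts being the
(finite, positive) numbers of left cosets in the two double cosets (★ `BettiPinning.finite_orbit_level`).  Hence the `B`-adjoint of
`[KgK]` is the positive rational multiple `(#(KgK/K)/#(Kg⁻¹K/K)) · [Kg⁻¹K]` — an element of the Hecke image — with no unimodularity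
input; under `hdeg` it is `bilin_toTower_heckeEnd_eq`. [cite: Liu2021, p. 133 (before (D.3)) and §4.2 (FJcycle.tex l. 2074)]
[cite: DiamondShurman2005, Prop. 5.5.2] -/
theorem bilin_toTower_ncard_smul_heckeEnd_eq (hD : T.IsogenyDescent) (B : LinearMap.BilinForm ℚ_[ℓ] (C.etaleH1Tower ℓ))
    (hB : ∀ (g : C.G) (x y : C.etaleH1Tower ℓ), B (T.etHeckeRep ℓ g x) (T.etHeckeRep ℓ g y) = B x y)
    (K : C5.SmallLevel C.S.K₀) (g : C.G) (φ ψ : C.etaleH1 ℓ K) :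
    (orbit K.1.1 ((g⁻¹ : C.G) : C.G ⧸ (K.1.1 : Subgroup C.G))).ncard •
        B (C.toTower ℓ K ((rationalTateAction (C.A K) ℓ (T.heckeEnd hD K g)).dualMap φ)) (C.toTower ℓ K ψ) =
      (orbit K.1.1 (g : C.G ⧸ (K.1.1 : Subgroup C.G))).ncard •
        B (C.toTower ℓ K φ) (C.toTower ℓ K ((rationalTateAction (C.A K) ℓ (T.heckeEnd hD K g⁻¹)).dualMap ψ)) := by
  have hfin := Sec42Data.BettiPinning.finite_orbit_level K g
  have hfin' := Sec42Data.BettiPinning.finite_orbit_level K g⁻¹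
  have hx := T.toTower_mem_fixedPoints ℓ K φ
  have hy := T.toTower_mem_fixedPoints ℓ K ψ
  rw [T.toTower_dualMap_rationalTateAction_heckeEnd ℓ hD K g φ, T.toTower_dualMap_rationalTateAction_heckeEnd ℓ hD K g⁻¹ ψ,
    invariantPairing_heckeOperator_apply_left (T.etHeckeRep ℓ) (T.etHeckeRep ℓ) B hB (K.1.1 : Subgroup C.G) g hfin hx hy,
    invariantPairing_heckeOperator_apply_right (T.etHeckeRep ℓ) (T.etHeckeRep ℓ) B hB (K.1.1 : Subgroup C.G) g⁻¹ hfin' hx hy,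
    ← Set.ncard_eq_toFinset_card _ hfin, ← Set.ncard_eq_toFinset_card _ hfin', smul_smul, smul_smul, mul_comm]
  -- `B (g·x) y = B x (g⁻¹·y)` by invariance
  congr 1
  have e : T.etHeckeRep ℓ g (T.etHeckeRep ℓ g⁻¹ (C.toTower ℓ K ψ)) = C.toTower ℓ K ψ := by
    rw [← Module.End.mul_apply, ← map_mul, mul_inv_cancel, map_one, Module.End.one_apply]
  conv_lhs => rw [← e]
  rw [hB]

/-- The two orbit counts at a small level are positive. [cite: Liu2021, §4.2 (FJcycle.tex l. 2074, 2154–2160)] -/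
theorem ncard_orbit_level_pos (K : C5.SmallLevel C.S.K₀) (g : C.G) :
    0 < (orbit K.1.1 (g : C.G ⧸ (K.1.1 : Subgroup C.G))).ncard :=
  (Set.ncard_pos (Sec42Data.BettiPinning.finite_orbit_level K g)).2 ⟨(g : C.G ⧸ (K.1.1 : Subgroup C.G)), mem_orbit_self _⟩

end Sec42Data.HeckeTranslates

end Literature.NumberTheory.Automorphic.Liu2021.AppendixC
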